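import Mathlib
import Summits.NavierStokesRegularity.OSWSelfSimilar.SheetNSLineLinearCore
import Summits.NavierStokesRegularity.OSWSelfSimilar.SheetNSLineMomentSignLaw
import Summits.NavierStokesRegularity.OSWSelfSimilar.SheetRWeakProfilePV
import Literature.Analysis.Fourier.HilbertTransformLineL2
import HarnessLib

/-!
# Viscous gCLM/OSW profile MODEL: THE CLM POINT `a = 0` OF THE NS-TYPE LINE IS EMPTY — sign-free, kernel

HONEST FRAMING (cell ns-blowup GROUP B «PROFILE SEARCH», zone Z3 = the 1-D viscous gCLM/OSW sheet; human rulings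
D-0035/D-0074): **1-D MODEL; not Euler, not Navier–Stokes; «violates: none — MODEL».** Nothing here is a statement about NS.

THE STATEMENT (census level, CENSUS-Z3 row Z3-E12⁻ clause (i′) «the Schochet corner `a = 0` is the divide»). On the NS-type
line `c_l = ½c_ω` of the gCLM/OSW sheet (`Literature.Analysis.FluidPDE.effectiveViscosity_half`; blow-up rate `c_ω > 0`, viscosity
`ε > 0`, ANY gauge), at the CLM point `a = 0`:
* `nsTypeLine_empty_of_a_eq_zero` — **there is NO nontrivial odd `C²` profile `Ω` with `|Ω′| ≤ M`, `|Ω(ξ)| ≤ C/(1+ξ²)`,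
  solving `F₁(c_ω, c_ω/2, a = 0, b = 1, ε; HΩ, 𝒰, Ω) ≡ 0` on `(0,∞)` with the genuine `hilbertTransform`, in the tail class
  «`ξ(HΩ)Ω ∈ L¹(0,∞)`, `ξΩ′ → 0`»: `Ω ≡ 0`.** SIGN-FREE (no E-signed / eventual-sign hypothesis), and VELOCITY-FREE: at `a = 0`
  the velocity `𝒰` enters `F₁` with coefficient `0`, so `𝒰` is an arbitrary function here (no `𝒰′ = HΩ`, no `𝒰Ω ∈ L¹`, no
  `ξ𝒰Ω → 0` needed) — in particular the theorem covers the decay class of `nsTypeLine_ESigned_empty_of_a_neg` /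
  `nsTypeLine_empty_of_a_neg_of_eventually_nonpos` verbatim.
* `nsTypeLine_tail_zero_of_a_eq_zero_noVelocity` — the `a = 0` tail law `ξ²Ω(ξ) → 0` re-derived WITHOUT the velocity
  (first-moment identity `(c_ω/2)ξ²Ω − ε(ξΩ′ − Ω) = ∫₀^ξ η(HΩ)Ω` + the moment null `∫₀^∞ ξ(HΩ)Ω = 0` of
  `SheetHalfLineMomentNull`), the input of the linear core.
MECHANISM = the LINEAR CORE (`SheetNSLineLinearCoreTail` / `SheetNSLineLinearCore`): given `h := HΩ` (continuous —
`SheetRWeakProfilePV.continuous_hilbertTransform_of_contDiff`; square integrable — `memLp_two_hilbertTransform`), the `a = 0`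
equation `εΩ″ = (c_ω − h)Ω + (c_ω/2)ξΩ′` is LINEAR in `Ω`; its decaying solutions are exactly the `ξ⁻²`-tailed ones
(`ξ²|Ω| ≤ (2/c_ω)∫_ξ^∞|ηhΩ|`, Grönwall at `+∞` and backward), and the tail law says the `ξ⁻²` amplitude vanishes at `a = 0`.
READING it supports (MODEL, steady; the lead's to letter): «at the divide `a = 0` the NS-type line carries NO `c_ω > 0` profile
at all — its only `a = 0` object is the corner itself (`c_ω = 0`, `SheetNSLineSchochetCorner`); the parabolic branch E½ is born
from the corner with `c_ω → 0` (SHEET §13) and cannot cross `a = 0` at a positive rate; consistent with the `a = 0` blow-up of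
the PDE being Schochet's `(T−t)^{−2}` (`SheetNSLineSchochetTwoPole`), never the NS-type `(T−t)^{−1}` profile».
NOT PROVED HERE: anything for `a ≠ 0`; anything dynamic; profiles outside the class (slower tails, `ξ(HΩ)Ω ∉ L¹(0,∞)`,
`ε = 0`); existence of E½; anything about Euler or NS. Tagged [new here — MODEL]; no definitions, standard axioms.
bears_on: LADDER-NS N5 / zone Z3 clause (i′) (CENSUS-Z3 v2.12 §0) → N1 linear core; SELFSIM-NOGO M7/M8 MODEL side.
-/

noncomputable section
open Set Filter Topology MeasureTheory
open scoped Real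

namespace Summit.NavierStokesRegularity.OSWSelfSimilar
namespace SheetHalfLine
open HouLuoOriginLaws (F1)
open Literature.Analysis.Fourier

/-- **The `a = 0` tail law without the velocity.** For an odd `C²` profile with `|Ω′| ≤ M`, `|Ω(ξ)| ≤ C/(1+ξ²)` solving
`F₁(c_ω, c_ω/2, 0, 1, ε; HΩ, 𝒰, Ω) ≡ 0` on `(0,∞)` (`𝒰` ARBITRARY — its coefficient is `a = 0`), with `ξ(HΩ)Ω ∈ L¹(0,∞)` and
`ξΩ′ → 0`: `ξ²Ω(ξ) → 0` (`c_ω ≠ 0`). Proof: `K := (c_ω/2)ξ²Ω − ε(ξΩ′ − Ω)` has `K′ = ξ(HΩ)Ω` on `(0,∞)` and `K(0) = 0`, so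
`K(R) = ∫₀^R ξ(HΩ)Ω → ∫₀^∞ ξ(HΩ)Ω = 0` (moment null). Compare `nsTypeLine_tail_zero_of_a_eq_zero` (same law, velocity class).
[new here — MODEL] -/
theorem nsTypeLine_tail_zero_of_a_eq_zero_noVelocity (cω ε M C : ℝ) (U Om dOm ddOm : ℝ → ℝ) (hcω : cω ≠ 0)
    (hodd : ∀ y, Om (-y) = -Om y)
    (hOm : ∀ ξ, HasDerivAt Om (dOm ξ) ξ) (hdOm : ∀ ξ, HasDerivAt dOm (ddOm ξ) ξ)
    (hM : ∀ y, |dOm y| ≤ M) (hC : ∀ y, |Om y| ≤ C / (1 + y ^ 2))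
    (hF : ∀ ξ ∈ Ioi (0:ℝ), F1 cω (cω / 2) 0 1 ε (hilbertTransform Om) U Om dOm ddOm (fun _ => 0) ξ = 0)
    (iH : IntegrableOn (fun ξ => ξ * (hilbertTransform Om ξ * Om ξ)) (Ioi 0))
    (hdOm1 : Tendsto (fun R => R * dOm R) atTop (𝓝 0)) :
    Tendsto (fun R => R ^ 2 * Om R) atTop (𝓝 0) := by
  have _hM := hM
  have hc : Continuous Om := continuous_iff_continuousAt.mpr fun x => (hOm x).continuousAt
  have hdOmc : Continuous dOm := continuous_iff_continuousAt.mpr fun x => (hdOm x).continuousAt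
  have hΩi := integrable_of_env hc hC
  have hmom := integral_Ioi_id_mul_hilbertTransform_mul_eq_zero hodd hΩi (memLp_two_of_env hc hC)
    (memLp_two_id_mul_of_env hc hC) (integrableOn_symmIntegrand_of_hasDerivAt hOm hdOmc hΩi)
  have hOm0 : Om 0 = 0 := by
    have h := hodd 0
    simp only [neg_zero] at h
    linarith
  -- the equation on `(0,∞)`
  have heq : ∀ ξ ∈ Ioi (0:ℝ), ε * ddOm ξ = cω * Om ξ + cω / 2 * ξ * dOm ξ - hilbertTransform Om ξ * Om ξ := by
    intro ξ hξ
    have h := hF ξ hξ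
    simp only [F1] at h
    linarith
  -- `K` and its derivative
  have hsq : ∀ η : ℝ, HasDerivAt (fun x : ℝ => x ^ 2) (2 * η) η := fun η => by
    simpa using hasDerivAt_pow 2 η
  have hK : ∀ η : ℝ, HasDerivAt (fun x => cω / 2 * (x ^ 2 * Om x) - ε * (x * dOm x - Om x))
      (cω / 2 * (2 * η * Om η + η ^ 2 * dOm η) - ε * (1 * dOm η + η * ddOm η - dOm η)) η := by
    intro η
    have h1 := ((hsq η).fun_mul (hOm η)).const_mul (cω / 2)
    have h2 := (((hasDerivAt_id' η).fun_mul (hdOm η)).fun_sub (hOm η)).const_mul ε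
    exact h1.fun_sub h2
  have hK' : ∀ η ∈ Ioi (0:ℝ), HasDerivAt (fun x => cω / 2 * (x ^ 2 * Om x) - ε * (x * dOm x - Om x))
      (η * (hilbertTransform Om η * Om η)) η := by
    intro η hη
    refine (hK η).congr_deriv ?_
    have e := heq η hη
    linear_combination (-η) * e
  have hKc : Continuous (fun x => cω / 2 * (x ^ 2 * Om x) - ε * (x * dOm x - Om x)) :=
    continuous_iff_continuousAt.mpr fun x => (hK x).continuousAt
  -- `K(R) = ∫₀^R ξ(HΩ)Ω` for `R > 0`
  have hKR : ∀ R ∈ Ioi (0:ℝ), cω / 2 * (R ^ 2 * Om R) - ε * (R * dOm R - Om R) =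
      ∫ ξ in (0:ℝ)..R, ξ * (hilbertTransform Om ξ * Om ξ) := by
    intro R hR
    have hRle : (0:ℝ) ≤ R := le_of_lt hR
    have hint : IntervalIntegrable (fun ξ => ξ * (hilbertTransform Om ξ * Om ξ)) volume 0 R :=
      (intervalIntegrable_iff_integrableOn_Ioc_of_le hRle).2 (iH.mono_set Ioc_subset_Ioi_self)
    have h := intervalIntegral.integral_eq_sub_of_hasDerivAt_of_le hRle hKc.continuousOn
      (fun x hx => hK' x hx.1) hint
    rw [h, hOm0]
    simp
  -- hence `K(R) → 0`
  have hKlim : Tendsto (fun R => cω / 2 * (R ^ 2 * Om R) - ε * (R * dOm R - Om R)) atTop (𝓝 0) := by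
    have h1 := intervalIntegral_tendsto_integral_Ioi 0 iH tendsto_id
    rw [hmom] at h1
    refine h1.congr' ?_
    filter_upwards [Ioi_mem_atTop (0:ℝ)] with R hR
    exact (hKR R hR).symm
  -- and `(c_ω/2)ξ²Ω → 0`
  have hlim : Tendsto (fun R => cω / 2 * (R ^ 2 * Om R)) atTop (𝓝 0) := by
    have h := hKlim.add ((hdOm1.sub (tendsto_zero_of_env hC)).const_mul ε)
    simp only [sub_zero, mul_zero, add_zero] at h
    refine h.congr' (Eventually.of_forall fun R => ?_)
    simp only
    ring
  have h' := hlim.const_mul (cω / 2)⁻¹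
  simp only [mul_zero] at h'
  refine h'.congr' (Eventually.of_forall fun R => ?_)
  field_simp

/-- **THE CENSUS DECL: THE CLM POINT `a = 0` OF THE NS-TYPE LINE IS EMPTY — SIGN-FREE, VELOCITY-FREE.** On the NS-type line
`c_l = c_ω/2` of the gCLM/OSW sheet (`Literature.Analysis.FluidPDE.effectiveViscosity_half`), for every blow-up rate `c_ω > 0`
and every viscosity `ε > 0`, at `a = 0`: an odd `C²` profile `Ω` (`Ω′ = dOm`, `Ω″ = ddOm`) with `|Ω′| ≤ M`,
`|Ω(ξ)| ≤ C/(1+ξ²)`, solving `F₁(c_ω, c_ω/2, 0, 1, ε; HΩ, 𝒰, Ω) ≡ 0` on `(0,∞)` with the GENUINE `hilbertTransform` (and an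
ARBITRARY `𝒰`, whose coefficient is `a = 0`), in the tail class «`ξ(HΩ)Ω ∈ L¹(0,∞)`, `ξΩ′(ξ) → 0`», is `≡ 0`. No sign hypothesis.
Proof: the linear core `linearCore_eqOn_zero` with `h = HΩ` (continuous, `L²`) and the `a = 0` tail law `ξ²Ω → 0`
(`nsTypeLine_tail_zero_of_a_eq_zero_noVelocity`); oddness. It strictly contains the classes of `nsTypeLine_ESigned_empty_of_a_neg`
(p540197) and `nsTypeLine_empty_of_a_neg_of_eventually_nonpos` (p547035) at the endpoint `a = 0`, which those theorems exclude.
[new here — MODEL] -/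
theorem nsTypeLine_empty_of_a_eq_zero (cω ε M C : ℝ) (U Om dOm ddOm : ℝ → ℝ) (hcω : 0 < cω) (hε : 0 < ε)
    (hodd : ∀ y, Om (-y) = -Om y)
    (hOm : ∀ ξ, HasDerivAt Om (dOm ξ) ξ) (hdOm : ∀ ξ, HasDerivAt dOm (ddOm ξ) ξ)
    (hM : ∀ y, |dOm y| ≤ M) (hC : ∀ y, |Om y| ≤ C / (1 + y ^ 2))
    (hF : ∀ ξ ∈ Ioi (0:ℝ), F1 cω (cω / 2) 0 1 ε (hilbertTransform Om) U Om dOm ddOm (fun _ => 0) ξ = 0)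
    (iH : IntegrableOn (fun ξ => ξ * (hilbertTransform Om ξ * Om ξ)) (Ioi 0))
    (hdOm1 : Tendsto (fun R => R * dOm R) atTop (𝓝 0)) : Om = 0 := by
  have hc : Continuous Om := continuous_iff_continuousAt.mpr fun x => (hOm x).continuousAt
  have hdOmc : Continuous dOm := continuous_iff_continuousAt.mpr fun x => (hdOm x).continuousAt
  have hΩi := integrable_of_env hc hC
  have hsymm := integrableOn_symmIntegrand_of_hasDerivAt hOm hdOmc hΩi
  -- `h = HΩ` is continuous and square integrable
  have h1 : ContDiff ℝ 1 Om := by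
    rw [contDiff_one_iff_deriv]
    exact ⟨fun y => (hOm y).differentiableAt, by
      rw [show deriv Om = dOm from funext fun y => (hOm y).deriv]; exact hdOmc⟩
  have hh : Continuous (hilbertTransform Om) := SheetRWeakProfilePV.continuous_hilbertTransform_of_contDiff h1 hΩi
  have hh2 : MemLp (hilbertTransform Om) 2 := memLp_two_hilbertTransform hΩi (memLp_two_of_env hc hC) (ae_of_all _ hsymm)
  -- the linear equation on `(0,∞)`
  have heq : ∀ ξ ∈ Ioi (0:ℝ), ε * ddOm ξ = cω * Om ξ + cω / 2 * ξ * dOm ξ - hilbertTransform Om ξ * Om ξ := by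
    intro ξ hξ
    have h := hF ξ hξ
    simp only [F1] at h
    linarith
  -- the `a = 0` tail law and the linear core
  have htail := nsTypeLine_tail_zero_of_a_eq_zero_noVelocity cω ε M C U Om dOm ddOm hcω.ne' hodd hOm hdOm hM hC hF iH hdOm1
  have hIoi := linearCore_eqOn_zero hcω hε hh hh2 hOm hdOm heq iH (tendsto_zero_of_env hC) hdOm1 htail
  exact eq_zero_of_odd_of_eqOn_Ioi hodd fun ξ hξ => hIoi ξ hξ

/-- **Corollary in the velocity class of the census** (the binders of `nsTypeLine_ESigned_empty_of_a_neg` with `a = 0` and NO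
sign hypothesis): with the MODEL velocity `𝒰` (`𝒰′ = HΩ`, `𝒰(0) = 0`) and the four tail conditions, `a = 0` ⇒ `Ω ≡ 0` — so on the
NS-type line the tail-sign trichotomy of `SheetNSLineTailSign` (`a < 0`: positive `ξ⁻²` tail; `a > 0`: negative; `a = 0`: none)
sharpens at the CLM point to «`a = 0`: NO PROFILE». (The velocity hypotheses are used only to place the statement in that
class; the proof is `nsTypeLine_empty_of_a_eq_zero`.) [new here — MODEL] -/
theorem nsTypeLine_empty_of_a_eq_zero_velocityClass (cω ε M C : ℝ) (U Om dOm ddOm : ℝ → ℝ) (hcω : 0 < cω) (hε : 0 < ε)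
    (hodd : ∀ y, Om (-y) = -Om y)
    (hOm : ∀ ξ, HasDerivAt Om (dOm ξ) ξ) (hdOm : ∀ ξ, HasDerivAt dOm (ddOm ξ) ξ)
    (hM : ∀ y, |dOm y| ≤ M) (hC : ∀ y, |Om y| ≤ C / (1 + y ^ 2))
    (hU : ∀ ξ, HasDerivAt U (hilbertTransform Om ξ) ξ) (hU0 : U 0 = 0)
    (hF : ∀ ξ ∈ Ioi (0:ℝ), F1 cω (cω / 2) 0 1 ε (hilbertTransform Om) U Om dOm ddOm (fun _ => 0) ξ = 0)
    (iUOm : IntegrableOn (fun ξ => U ξ * Om ξ) (Ioi 0))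
    (iH : IntegrableOn (fun ξ => ξ * (hilbertTransform Om ξ * Om ξ)) (Ioi 0))
    (hUOm : Tendsto (fun R => R * U R * Om R) atTop (𝓝 0))
    (hdOm1 : Tendsto (fun R => R * dOm R) atTop (𝓝 0)) :
    Om = 0 ∧ (∫ ξ in Ioi (0:ℝ), U ξ * Om ξ) = 0 ∧ U = fun ξ => ∫ t in (0:ℝ)..ξ, hilbertTransform Om t := by
  have hz := nsTypeLine_empty_of_a_eq_zero cω ε M C U Om dOm ddOm hcω hε hodd hOm hdOm hM hC hF iH hdOm1
  have _h1 := iUOm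
  have _h2 := hUOm
  refine ⟨hz, ?_, ?_⟩
  · simp [hz]
  · -- `𝒰` is the primitive of `HΩ` vanishing at `0`
    have hcU : Continuous U := continuous_iff_continuousAt.mpr fun x => (hU x).continuousAt
    funext ξ
    have hHc : Continuous (hilbertTransform Om) := by
      rw [hz]
      have : hilbertTransform (0 : ℝ → ℝ) = fun _ => 0 := by
        funext x; simp [hilbertTransform]
      rw [this]; exact continuous_const
    have h := intervalIntegral.integral_eq_sub_of_hasDerivAt (f := U) (a := 0) (b := ξ)
      (fun x _ => hU x) (hHc.intervalIntegrable 0 ξ)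
    rw [h, hU0, sub_zero]

end SheetHalfLine
end Summit.NavierStokesRegularity.OSWSelfSimilar
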